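import Literature.MathematicalPhysics.QuantumFieldTheory.YangMillsOS
import Literature.MathematicalPhysics.QuantumFieldTheory.LatticeGaugeProofs
import HarnessLib

/-!
# Crux `NonSimplyConnectedLatticeGap` (stmt-QuantumFields-16405), route `ConvexGribovBody`,
# line `Sketch` — stub `stub_corrPullbackCover` (K1: the covering theory has the same correlations)

For a continuous SURJECTIVE homomorphism `π : H →* G` of compact groups (the case in point is the
universal cover `G̃ → G` of a compact simple gauge group with `π₁(G) ≠ 0`, e.g.
`rotHom : S³ →* SO(3)`), the Wilson lattice gauge theory of `H` in the pulled-back representation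
`ρ ∘ π` IS the Wilson theory of `G` in the representation `ρ`, seen through the link-wise map of
configurations `Φ V = π ∘ V`:

* `π_* Haar_H = Haar_G` — a continuous surjective homomorphism onto a compact group pushes the Haar
  probability measure to the Haar probability measure (Mathlib `MonoidHom.measurePreserving`:
  left invariance of the push-forward uses surjectivity, then uniqueness and total mass `1`), and
  the finite product over the torus links is transported (`measurePreserving_pi`;
  `map_pi_haarProbability_comp_of_surjective`);
* the Wilson density factors through `Φ`: `S_{ρ∘π}(V) = S_ρ(Φ V)`, because `π` maps plaquette
  holonomies to plaquette holonomies (`corrPullback_wilsonAction_comp`);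
* hence `Φ_* (e^{-β S_{ρ∘π}} dHaar_H^{⊗E}) = e^{-β S_ρ} dHaar_G^{⊗E}` (push-forward of a
  pulled-back density along a measurable map, `corrPullback_map_wilsonWeight_comp`), the partition
  functions agree, and `Φ_* μ^{(H, ρ∘π)}_{Λ,β} = μ^{(G, ρ)}_{Λ,β}`
  (`map_wilsonMeasure_comp_of_surjective`);
* Wilson expectations of pulled-back observables agree
  (`integral_wilsonMeasure_comp_of_surjective`), and since the periodic lift `torusLift` and the
  lattice translations `configShift` commute with `Φ`, so do the connected torus
  time-correlations `latticeConnectedCorr` (`stub_corrPullbackCover`).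
-/

set_option autoImplicit false

noncomputable section

open MeasureTheory
open scoped ENNReal

namespace Summit.QuantumFields.YangMills.Theorems.NonSimplyConnectedLatticeGap

open Literature.MathematicalPhysics.QuantumFieldTheory Literature.MathematicalPhysics.QuantumLattice

section Shift

variable {d : ℕ} {G H : Type*} [MeasurableSpace G] [MeasurableSpace H]

/-- The lattice translations of `ℤ^d`-configurations commute with any link-wise map:
`τ_v (f ∘ W) = f ∘ (τ_v W)`. [folklore] -/
theorem corrPullback_configShift_comp (f : H → G) (v : Literature.Probability.LatticeModels.Site d)
    (W : LGConfig d H) :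
    configShift v (fun e => f (W e)) = fun e => f (configShift v W e) := by
  funext e
  simp only [configShift_apply]

end Shift

section Transport

variable {d L N : ℕ} {G H : Type*} [Group G] [Group H]

/-- **A homomorphism applied link-wise maps plaquette holonomies to plaquette holonomies**:
`U_p(π ∘ V) = π (U_p(V))` (`π` is multiplicative and commutes with inversion). [folklore] -/
theorem corrPullback_plaquetteHolonomy_comp (π : H →* G) (V : GaugeConfig d L H) (x : Site d L)
    (i j : Fin d) :
    plaquetteHolonomy (fun e => π (V e)) x i j = π (plaquetteHolonomy V x i j) := by
  simp only [plaquetteHolonomy, map_mul, map_inv]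

/-- **The Wilson density factors through the link-wise map**: the Wilson action of `V` in the
pulled-back representation `ρ ∘ π` is the Wilson action in `ρ` of the image configuration `π ∘ V`
(`corrPullback_plaquetteHolonomy_comp`, plaquette by plaquette). [folklore] -/
theorem corrPullback_wilsonAction_comp [NeZero L] (π : H →* G) (ρ : G →* Matrix (Fin N) (Fin N) ℂ)
    (V : GaugeConfig d L H) :
    wilsonAction (ρ.comp π) V = wilsonAction ρ (fun e => π (V e)) := by
  unfold wilsonAction
  refine Finset.sum_congr rfl fun p _ => ?_
  rw [corrPullback_plaquetteHolonomy_comp, MonoidHom.comp_apply]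

variable [TopologicalSpace G] [IsTopologicalGroup G] [CompactSpace G] [MeasurableSpace G]
  [BorelSpace G] [TopologicalSpace H] [IsTopologicalGroup H] [CompactSpace H] [MeasurableSpace H]
  [BorelSpace H]

omit [IsTopologicalGroup G] [CompactSpace G] [IsTopologicalGroup H] [CompactSpace H] in
/-- The link-wise map `V ↦ π ∘ V` of torus configurations is measurable for a continuous `π`.
[folklore] -/
theorem corrPullback_measurable_comp (π : H →* G) (hπ : Continuous π) :
    Measurable fun (V : GaugeConfig d L H) (e : Edge d L) => π (V e) :=
  measurable_pi_lambda _ fun e => hπ.measurable.comp (measurable_pi_apply e)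

/-- **A continuous surjective homomorphism of compact groups transports the Haar probability
measure**: `π_* Haar_H = Haar_G` (Mathlib `MonoidHom.measurePreserving`: the push-forward is left
invariant because `π` is onto, then uniqueness of Haar measure and total mass `1`). [folklore] -/
theorem measurePreserving_haarProbability_of_surjective (π : H →* G) (hπ : Continuous π)
    (hsurj : Function.Surjective π) :
    MeasurePreserving π (haarProbability H) (haarProbability G) :=
  MonoidHom.measurePreserving hπ hsurj (by rw [measure_univ, measure_univ])

/-- **The finite Haar product over the torus links is transported** by the link-wise map:
`Φ_* Haar_H^{⊗E} = Haar_G^{⊗E}` for `Φ V = π ∘ V` (Mathlib `measurePreserving_pi`). [folklore] -/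
theorem map_pi_haarProbability_comp_of_surjective [NeZero L] (π : H →* G) (hπ : Continuous π)
    (hsurj : Function.Surjective π) :
    (Measure.pi fun _ : Edge d L => haarProbability H).map
        (fun (V : GaugeConfig d L H) (e : Edge d L) => π (V e)) =
      Measure.pi fun _ : Edge d L => haarProbability G :=
  (measurePreserving_pi (fun _ : Edge d L => haarProbability H)
    (fun _ : Edge d L => haarProbability G)
    (fun _ => measurePreserving_haarProbability_of_surjective π hπ hsurj)).map_eq

variable [SecondCountableTopology G]

/-- **The un-normalised Wilson weights are transported**: `Φ_* (e^{-β S_{ρ∘π}} dHaar_H^{⊗E}) =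
e^{-β S_ρ} dHaar_G^{⊗E}`. The density of the `(H, ρ ∘ π)` weight is the pull-back `w ∘ Φ` of the
(measurable, `ρ` continuous) density `w = e^{-β S_ρ}` (`corrPullback_wilsonAction_comp`), and for a
measurable map `Φ` and a measurable `w`, `Φ_* ((w ∘ Φ) μ) = w (Φ_* μ)` (change of variables in the
lower Lebesgue integral), with `Φ_* Haar_H^{⊗E} = Haar_G^{⊗E}`
(`map_pi_haarProbability_comp_of_surjective`). [folklore] -/
theorem corrPullback_map_wilsonWeight_comp [NeZero L] (π : H →* G) (hπ : Continuous π)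
    (hsurj : Function.Surjective π) (ρ : G →* Matrix (Fin N) (Fin N) ℂ) (hρ : Continuous ρ)
    (β : ℝ) :
    (wilsonWeight (ρ.comp π) β).map (fun (V : GaugeConfig d L H) (e : Edge d L) => π (V e)) =
      wilsonWeight (d := d) (L := L) ρ β := by
  have hΦ := corrPullback_measurable_comp (d := d) (L := L) π hπ
  have hw : Measurable fun U : GaugeConfig d L G =>
      ENNReal.ofReal (Real.exp (-β * wilsonAction ρ U)) :=
    (Real.measurable_exp.comp ((measurable_wilsonAction ρ hρ).const_mul _)).ennreal_ofReal
  have hcomp : (fun V : GaugeConfig d L H =>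
      ENNReal.ofReal (Real.exp (-β * wilsonAction (ρ.comp π) V))) =
      (fun U : GaugeConfig d L G => ENNReal.ofReal (Real.exp (-β * wilsonAction ρ U))) ∘
        fun (V : GaugeConfig d L H) (e : Edge d L) => π (V e) := by
    funext V
    simp only [Function.comp_apply, corrPullback_wilsonAction_comp]
  unfold wilsonWeight
  rw [hcomp]
  ext s hs
  rw [Measure.map_apply hΦ hs, withDensity_apply _ (hΦ hs), withDensity_apply _ hs,
    ← map_pi_haarProbability_comp_of_surjective (d := d) (L := L) π hπ hsurj,
    Measure.restrict_map hΦ hs, lintegral_map hw hΦ]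
  rfl

/-- **The partition functions agree**: `Z^{(H, ρ∘π)}_{Λ,β} = Z^{(G, ρ)}_{Λ,β}` (total masses of the
transported weights, `corrPullback_map_wilsonWeight_comp`). [folklore] -/
theorem corrPullback_partitionFunction_comp [NeZero L] (π : H →* G) (hπ : Continuous π)
    (hsurj : Function.Surjective π) (ρ : G →* Matrix (Fin N) (Fin N) ℂ) (hρ : Continuous ρ)
    (β : ℝ) :
    partitionFunction (d := d) (L := L) (ρ.comp π) β =
      partitionFunction (d := d) (L := L) ρ β := by
  unfold partitionFunction
  rw [← corrPullback_map_wilsonWeight_comp π hπ hsurj ρ hρ β,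
    Measure.map_apply (corrPullback_measurable_comp π hπ) MeasurableSet.univ, Set.preimage_univ]

/-- **The torus Wilson states are pulled back along a continuous surjective homomorphism of compact
groups**: `Φ_* μ^{(H, ρ∘π)}_{Λ,β} = μ^{(G, ρ)}_{Λ,β}` for `Φ V = π ∘ V` — the weights are
transported (`corrPullback_map_wilsonWeight_comp`) and the normalisations agree
(`corrPullback_partitionFunction_comp`). For the universal cover `π : G̃ → G` this is "the periodic
`(G, ρ)`-theory is the `(G̃, ρ ∘ π)`-theory". [folklore] -/
theorem map_wilsonMeasure_comp_of_surjective [NeZero L] (π : H →* G) (hπ : Continuous π)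
    (hsurj : Function.Surjective π) (ρ : G →* Matrix (Fin N) (Fin N) ℂ) (hρ : Continuous ρ)
    (β : ℝ) :
    (wilsonMeasure (ρ.comp π) β).map (fun (V : GaugeConfig d L H) (e : Edge d L) => π (V e)) =
      wilsonMeasure (d := d) (L := L) ρ β := by
  unfold wilsonMeasure
  rw [Measure.map_smul, corrPullback_map_wilsonWeight_comp π hπ hsurj ρ hρ β,
    corrPullback_partitionFunction_comp π hπ hsurj ρ hρ β]

/-- **Wilson expectations of pulled-back observables agree**: for a measurable real observable `F`
of `G`-configurations, `∫ F(π ∘ V) dμ^{(H, ρ∘π)}_{Λ,β}(V) = ∫ F dμ^{(G, ρ)}_{Λ,β}` (change of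
variables along `map_wilsonMeasure_comp_of_surjective`). [folklore] -/
theorem integral_wilsonMeasure_comp_of_surjective [NeZero L] (π : H →* G) (hπ : Continuous π)
    (hsurj : Function.Surjective π) (ρ : G →* Matrix (Fin N) (Fin N) ℂ) (hρ : Continuous ρ)
    (β : ℝ) {F : GaugeConfig d L G → ℝ} (hF : Measurable F) :
    ∫ V, F (fun e => π (V e)) ∂(wilsonMeasure (ρ.comp π) β) =
      ∫ U, F U ∂(wilsonMeasure (d := d) (L := L) ρ β) := by
  rw [← map_wilsonMeasure_comp_of_surjective π hπ hsurj ρ hρ β,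
    integral_map (corrPullback_measurable_comp π hπ).aemeasurable hF.aestronglyMeasurable]

end Transport

/-- **STUB K1 — the covering theory has the same correlations.** For a continuous surjective
homomorphism `π : H →* G` of compact groups (`G` second countable), a continuous representation `ρ`
of `G`, measurable observables `A, B` of `G`-configurations on `ℤ⁴` and every torus `S`, time `n`,
coupling `β`: the connected torus time-correlation of the pulled-back observables `A(π ∘ ·)`,
`B(π ∘ ·)` in the `(H, ρ ∘ π)` Wilson theory equals that of `A, B` in the `(G, ρ)` theory. The
`(H, ρ ∘ π)` Wilson measure pushes forward to the `(G, ρ)` one under `V ↦ π ∘ V`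
(`map_wilsonMeasure_comp_of_surjective`), and the periodic lift and the time translation commute
with `V ↦ π ∘ V`, so each of the three Wilson expectations in `latticeConnectedCorr` agrees
(`integral_wilsonMeasure_comp_of_surjective`). [folklore] -/
theorem stub_corrPullbackCover :
    ∀ (G H : Type) [Group G] [TopologicalSpace G] [IsTopologicalGroup G] [CompactSpace G]
      [MeasurableSpace G] [BorelSpace G] [SecondCountableTopology G]
      [Group H] [TopologicalSpace H] [IsTopologicalGroup H] [CompactSpace H]
      [MeasurableSpace H] [BorelSpace H] (π : H →* G), Continuous π → Function.Surjective π →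
      ∀ (N : ℕ) (ρ : G →* Matrix (Fin N) (Fin N) ℂ), Continuous ρ → ∀ (β : ℝ) (S : ℕ) [NeZero S]
        (A B : Literature.MathematicalPhysics.QuantumLattice.LGConfig 4 G → ℝ), Measurable A → Measurable B →
      ∀ n : ℕ,
        Literature.MathematicalPhysics.QuantumFieldTheory.latticeConnectedCorr (ρ.comp π) β S
            (fun V => A (fun e => π (V e))) (fun V => B (fun e => π (V e))) n =
          Literature.MathematicalPhysics.QuantumFieldTheory.latticeConnectedCorr ρ β S A B n := by
  intro G H _ _ _ _ _ _ _ _ _ _ _ _ _ π hπ hsurj N ρ hρ β S _ A B hA hB n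
  -- measurability of the three `G`-side integrands
  have hT : Measurable (torusLift (d := 4) (G := G) S) := measurable_torusLift S
  have hτ : ∀ v : Literature.Probability.LatticeModels.Site 4,
      Measurable (configShift (G := G) v) := fun v => (configShift (G := G) v).measurable
  have hA' : Measurable fun U : GaugeConfig 4 S G => A (torusLift S U) := hA.comp hT
  have hB' : Measurable fun U : GaugeConfig 4 S G => B (torusLift S U) := hB.comp hT
  have hAB : Measurable fun U : GaugeConfig 4 S G =>
      A (torusLift S U) * B (configShift (-Pi.single 0 (n : ℤ)) (torusLift S U)) :=
    hA'.mul (hB.comp ((hτ _).comp hT))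
  -- the three Wilson expectations agree (`V ↦ π ∘ V` pushes `μ^{(H, ρ∘π)}` to `μ^{(G, ρ)}`)
  have h1 := integral_wilsonMeasure_comp_of_surjective (d := 4) (L := S) π hπ hsurj ρ hρ β hAB
  have h2 := integral_wilsonMeasure_comp_of_surjective (d := 4) (L := S) π hπ hsurj ρ hρ β hA'
  have h3 := integral_wilsonMeasure_comp_of_surjective (d := 4) (L := S) π hπ hsurj ρ hρ β hB'
  unfold latticeConnectedCorr
  rw [← h1, ← h2, ← h3]
  -- the periodic lift and the time translation commute with `V ↦ π ∘ V`
  have htl : ∀ V : GaugeConfig 4 S H,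
      torusLift S (fun e => π (V e)) = fun e => π (torusLift S V e) := fun V => rfl
  simp only [htl, corrPullback_configShift_comp]

end Summit.QuantumFields.YangMills.Theorems.NonSimplyConnectedLatticeGap

end
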